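import Summits.RiemannHypothesis.RiemannHypothesis.Theorems.ThetaTier2Round
import Summits.RiemannHypothesis.RiemannHypothesis.Theorems.ThetaTier2Sin
import Mathlib.Analysis.Real.Pi.Bounds
import HarnessLib

/-!
# THETA tier-2 kernel checker — `sinSup` IS an upper bound of `sup |sin|` on the cell (cc-s2-1, WEIL typing lane; RH-FREE)

The kernel link of LEMMA S (HOME/cc-s2-1/gen22/TIER2-KERNEL-SPEC.md §2): for naturals read as `val x = x/2⁹⁶`,

* `abs_sin_le_val_p5U` : `|θ − nπ| ≤ val d ⇒ |sin θ| ≤ val (p5U d)` (the fixed-point `P₅` rounds up; cap `1` beyond `79/50`);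
* `exists_abs_sub_le_val_distU` : with `π ∈ [val piL, val piH]`, `val (distU θ piL piH)` bounds `|val θ − nπ|` for some `n ∈ ℤ`;
* `hit_of_mem` : a critical point `(n + ½)π ∈ [val lo, val hi]` makes `hit lo hi piL piH n = true`;
* `sinSup_sound` : `π ∈ [val piL, val piH]`, `val piH − val piL ≤ 2⁻³⁰`, `val hi ≤ 2²⁴`, `θ ∈ [val lo, val hi]` ⇒
  `|sin θ| ≤ val (sinSup lo hi piL piH)` — the window claim (the only candidate that can matter is `n₀ = ⌊hi/piH⌋`) is PROVED
  from the two side conditions, which every row's data satisfies with room (`π`-enclosure of width `2⁻⁶⁴`, `θ ≤ 6·θ₀e³ < 10³`).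

Nothing here bears on the truth of RH.
-/

set_option linter.dupNamespace false  -- the mandated namespace repeats `RiemannHypothesis`
set_option autoImplicit false

namespace Summit.RiemannHypothesis.RiemannHypothesis.Theorems.ThetaTier2

open Real

/-! ## Two more rounding facts (floor / ceiling quotients by a plain natural) -/

/-- `val (a / k) ≤ a/(k·S)` (floor). [this cell] -/
theorem val_natDiv_le (a k : ℕ) : val (a / k) ≤ (a : ℝ) / ((k : ℝ) * (S : ℝ)) := by
  unfold val
  rw [← div_div]
  exact div_le_div_of_nonneg_right (Nat.cast_div_le) (by rw [S_cast_eq]; positivity)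

/-- `a/(k·S) ≤ val ((a + (k−1)) / k)` (ceiling). [this cell] -/
theorem le_val_ceilDiv' (a k : ℕ) (hk : 0 < k) : (a : ℝ) / ((k : ℝ) * (S : ℝ)) ≤ val ((a + (k - 1)) / k) := by
  have h := le_mul_ceilDiv a k hk
  have hk' : (0 : ℝ) < k := by exact_mod_cast hk
  have hS : (0 : ℝ) < (S : ℝ) := by rw [S_cast_eq]; positivity
  unfold val
  rw [div_le_div_iff₀ (mul_pos hk' hS) hS]
  have h' : ((a : ℕ) : ℝ) ≤ ((k * ((a + (k - 1)) / k) : ℕ) : ℝ) := by exact_mod_cast h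
  push_cast at h'
  nlinarith

/-! ## `p5U` -/

/-- **`|θ − nπ| ≤ val d ⇒ |sin θ| ≤ val (p5U d)`.** [this cell, TIER2-KERNEL-SPEC §2 LEMMA S] -/
theorem abs_sin_le_val_p5U {θ : ℝ} {d : ℕ} (n : ℤ) (hd : |θ - n * π| ≤ val d) : |sin θ| ≤ val (p5U d) := by
  have hS : (0 : ℝ) < (S : ℝ) := by rw [S_cast_eq]; positivity
  have hSpos : 0 < S := by rw [S_eq_two_pow]; positivity
  unfold p5U
  by_cases h1 : d * 50 ≥ 79 * S
  · rw [if_pos h1, val_S]; exact abs_sin_le_one θ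
  rw [if_neg h1]
  dsimp only
  by_cases h2 : d - d * d * d / (6 * S * S) + (d ^ 5 + (120 * S ^ 4 - 1)) / (120 * S ^ 4) < S
  · rw [if_pos h2]
    -- the quintic branch: val d < 79/50 and the rounded value is below the cap
    have hd79 : val d ≤ 79 / 50 := by
      have : d * 50 < 79 * S := not_le.1 h1
      have h' : ((d * 50 : ℕ) : ℝ) < ((79 * S : ℕ) : ℝ) := by exact_mod_cast this
      push_cast at h'
      unfold val; rw [div_le_iff₀ hS]; linarith
    refine (abs_sin_le_quintic_of_dist n hd hd79).trans ?_
    -- d3 ≤ d (so the natural subtraction is exact)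
    have hdS : d ≤ 2 * S := by
      have : d * 50 < 79 * S := not_le.1 h1
      omega
    have hd3le : d * d * d / (6 * S * S) ≤ d := by
      apply Nat.div_le_of_le_mul
      have : d * d ≤ 6 * S * S := by nlinarith
      nlinarith
    have hd3 : val (d * d * d / (6 * S * S)) ≤ val d ^ 3 / 6 := by
      have := val_natDiv_le (d * d * d) (6 * S * S)
      refine this.trans (le_of_eq ?_)
      unfold val; push_cast; rw [S_cast_eq]; ring
    have hd5 : val d ^ 5 / 120 ≤ val ((d ^ 5 + (120 * S ^ 4 - 1)) / (120 * S ^ 4)) := by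
      have := le_val_ceilDiv' (d ^ 5) (120 * S ^ 4) (by rw [S_eq_two_pow]; positivity)
      refine (le_of_eq ?_).trans this
      unfold val; push_cast; rw [S_cast_eq]; ring
    have hsub : val (d - d * d * d / (6 * S * S) + (d ^ 5 + (120 * S ^ 4 - 1)) / (120 * S ^ 4)) =
        val d - val (d * d * d / (6 * S * S)) + val ((d ^ 5 + (120 * S ^ 4 - 1)) / (120 * S ^ 4)) := by
      unfold val; push_cast [hd3le]; ring
    rw [hsub]
    linarith
  · rw [if_neg h2, val_S]; exact abs_sin_le_one θ

/-! ## `distU` -/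

/-- `|x − y| ≤ max |x − a| |x − b|` for `y ∈ [a, b]`. [folklore] -/
theorem abs_sub_le_max_of_mem {x y a b : ℝ} (ha : a ≤ y) (hb : y ≤ b) : |x - y| ≤ max |x - a| |x - b| := by
  rcases le_total y x with h | h
  · exact (le_max_left _ _).trans' (by rw [abs_of_nonneg (by linarith : 0 ≤ x - y)]; exact (le_abs_self _).trans' (by linarith))
  · exact (le_max_right _ _).trans' (by rw [abs_of_nonpos (by linarith : x - y ≤ 0)]; exact (neg_le_abs _).trans' (by linarith))

/-- Each candidate bound dominates the distance to that multiple of `π`. [this cell] -/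
theorem abs_sub_le_val_cand (θ piL piH n : ℕ) (hπ : val piL ≤ π ∧ π ≤ val piH) :
    |val θ - (n : ℝ) * π| ≤ val (cand θ piL piH n) := by
  unfold cand
  rw [val_max, val_absdiff, val_absdiff, val_nat_mul, val_nat_mul]
  exact abs_sub_le_max_of_mem (mul_le_mul_of_nonneg_left hπ.1 (Nat.cast_nonneg n))
    (mul_le_mul_of_nonneg_left hπ.2 (Nat.cast_nonneg n))

/-- **`val (distU θ piL piH) ≥ |val θ − nπ|` for some integer `n`** (any `π`-enclosure). [this cell, TIER2-KERNEL-SPEC §2 LEMMA S] -/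
theorem exists_abs_sub_le_val_distU (θ piL piH : ℕ) (hπ : val piL ≤ π ∧ π ≤ val piH) :
    ∃ n : ℤ, |val θ - n * π| ≤ val (distU θ piL piH) := by
  have hc : ∀ k : ℕ, ∃ n : ℤ, |val θ - n * π| ≤ val (cand θ piL piH k) :=
    fun k => ⟨k, by exact_mod_cast abs_sub_le_val_cand θ piL piH k hπ⟩
  -- a `min` of candidate bounds is one of them
  have hmin : ∀ a b : ℕ, (∃ n : ℤ, |val θ - n * π| ≤ val a) → (∃ n : ℤ, |val θ - n * π| ≤ val b) →
      ∃ n : ℤ, |val θ - n * π| ≤ val (min a b) := by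
    intro a b ha hb
    rcases min_choice a b with h | h <;> rw [h]
    · exact ha
    · exact hb
  unfold distU
  dsimp only
  split_ifs with h0
  · exact hmin _ _ (hc _) (hmin _ _ (hc _) (hc _))
  · exact hmin _ _ (hmin _ _ (hc _) (hmin _ _ (hc _) (hc _))) (hc _)

/-! ## `hit` and the window -/

/-- A critical point `(n + ½)π` inside `[val lo, val hi]` is detected by `hit`. [this cell, TIER2-KERNEL-SPEC §2 LEMMA S] -/
theorem hit_of_mem {lo hi piL piH : ℕ} (n : ℕ) (hπ : val piL ≤ π ∧ π ≤ val piH)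
    (hlo : val lo ≤ ((n : ℝ) + 1 / 2) * π) (hhi : ((n : ℝ) + 1 / 2) * π ≤ val hi) :
    hit lo hi piL piH n = true := by
  have hn : (0 : ℝ) ≤ (n : ℝ) + 1 / 2 := by positivity
  have ha : val ((2 * n + 1) * piL / 2) ≤ val hi := by
    refine (val_natDiv_le _ 2).trans ?_
    have : (((2 * n + 1) * piL : ℕ) : ℝ) / ((2 : ℕ) * (S : ℝ)) = ((n : ℝ) + 1 / 2) * val piL := by
      unfold val; push_cast; ring
    rw [this]
    exact (mul_le_mul_of_nonneg_left hπ.1 hn).trans hhi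
  have hb : val lo ≤ val (((2 * n + 1) * piH + 1) / 2) := by
    have h2 := le_val_ceilDiv' ((2 * n + 1) * piH) 2 (by norm_num)
    have : (((2 * n + 1) * piH : ℕ) : ℝ) / ((2 : ℕ) * (S : ℝ)) = ((n : ℝ) + 1 / 2) * val piH := by
      unfold val; push_cast; ring
    rw [this] at h2
    exact (hlo.trans (mul_le_mul_of_nonneg_left hπ.2 hn)).trans h2
  rw [val_le_val] at ha hb
  unfold hit
  simp only [Bool.not_eq_true', Bool.or_eq_false_iff, decide_eq_false_iff_not, not_lt]
  exact ⟨hb, ha⟩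

/-- The crossing test of `sinSup` as a named Boolean (the four candidate multiples around `n₀ = ⌊hi/π_H⌋`). [this cell] -/
def crossB (lo hi piL piH : ℕ) : Bool :=
  let n0 := hi / piH
  hit lo hi piL piH n0 || hit lo hi piL piH (n0 + 1) ||
    (if n0 ≥ 1 then hit lo hi piL piH (n0 - 1) else false) || (if n0 ≥ 2 then hit lo hi piL piH (n0 - 2) else false)

/-- `sinSup` unfolded through `crossB` (definitional). [this cell] -/
theorem sinSup_eq (lo hi0 piL piH : ℕ) : sinSup lo hi0 piL piH =
    (let hi := if hi0 < lo then lo else hi0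
     if 2 * (hi - lo) ≥ piL then S else
     if crossB lo hi piL piH then S else max (p5U (distU lo piL piH)) (p5U (distU hi piL piH))) := rfl

/-- **`sinSup` is sound**: with a `π`-enclosure of width `≤ 2⁻³⁰` and `val hi ≤ 2²⁴`, every `θ ∈ [val lo, val hi]` has
`|sin θ| ≤ val (sinSup lo hi piL piH)`. [this cell, TIER2-KERNEL-SPEC §2 LEMMA S] -/
theorem sinSup_sound {lo hi piL piH : ℕ} (hπ : val piL ≤ π ∧ π ≤ val piH)
    (hw : val piH - val piL ≤ 1 / 2 ^ 30) (hsz : val hi ≤ 2 ^ 24)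
    {θ : ℝ} (h1 : val lo ≤ θ) (h2 : θ ≤ val hi) :
    |sin θ| ≤ val (sinSup lo hi piL piH) := by
  have hle : lo ≤ hi := val_le_val.1 (h1.trans h2)
  have hpi3 : (3 : ℝ) < π := pi_gt_three
  have hpi4 : π ≤ 4 := pi_le_four
  have hpiL : 3 - 1 / 2 ^ 30 ≤ val piL := by linarith [hπ.2]
  have hpiLpos : 0 < val piL := by linarith
  have hpiHpos : 0 < val piH := by linarith [hπ.2]
  have hpiHnat : 0 < piH :=
    Nat.pos_of_ne_zero (fun h => by rw [h, val_zero] at hpiHpos; exact lt_irrefl _ hpiHpos)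
  have hS : (0 : ℝ) < (S : ℝ) := by rw [S_cast_eq]; positivity
  rw [sinSup_eq]
  dsimp only
  rw [if_neg (not_lt.2 hle)]
  by_cases hA : 2 * (hi - lo) ≥ piL
  · rw [if_pos hA, val_S]; exact abs_sin_le_one θ
  rw [if_neg hA]
  cases hc : crossB lo hi piL piH
  case true => rw [if_pos rfl, val_S]; exact abs_sin_le_one θ
  case false =>
    rw [if_neg (by simp)]
    -- main branch: no critical point inside, endpoint bound
    have hwidth : val hi - val lo < val piL / 2 := by
      have hA' : 2 * (hi - lo) < piL := not_le.1 hA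
      have h' : ((2 * (hi - lo) : ℕ) : ℝ) < ((piL : ℕ) : ℝ) := by exact_mod_cast hA'
      push_cast [hle] at h'
      have key : ((hi : ℝ) - lo) / S < ((piL : ℝ) / 2) / S := div_lt_div_of_pos_right (by linarith) hS
      unfold val
      calc (hi : ℝ) / S - lo / S = ((hi : ℝ) - lo) / S := by ring
        _ < ((piL : ℝ) / 2) / S := key
        _ = (piL : ℝ) / S / 2 := by ring
    -- the floor n₀ = hi / piH :  n₀·piH ≤ hi < (n₀+1)·piH
    set n0 : ℕ := hi / piH with hn0
    have f5 : (n0 : ℝ) * val piH ≤ val hi := by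
      have h := Nat.div_mul_le_self hi piH
      have := val_mono h
      rwa [val_nat_mul] at this
    have f1 : val hi < ((n0 : ℝ) + 1) * val piH := by
      have h := Nat.lt_div_mul_add (a := hi) hpiHnat
      have h' : hi < (n0 + 1) * piH := by rw [hn0, add_one_mul]; exact h
      have := val_lt_val.2 h'
      rw [val_nat_mul] at this
      push_cast at this
      exact this
    have f3 : (n0 : ℝ) ≤ 2 ^ 24 / 3 := by
      have : (n0 : ℝ) * 3 ≤ val hi := (mul_le_mul_of_nonneg_left (by linarith : (3 : ℝ) ≤ val piH) (Nat.cast_nonneg n0)).trans f5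
      linarith
    -- no critical point in [val lo, val hi]
    have hnocrit : ∀ n : ℤ, ((n : ℝ) + 1 / 2) * π < val lo ∨ val hi < ((n : ℝ) + 1 / 2) * π := by
      intro n
      by_contra hcon
      rw [not_or, not_lt, not_lt] at hcon
      obtain ⟨hcl, hch⟩ := hcon
      -- n ≤ n0
      have hup : n ≤ (n0 : ℤ) := by
        by_contra hgt
        have hgt' : (n0 : ℝ) + 1 ≤ n := by exact_mod_cast (show (n0 : ℤ) + 1 ≤ n by omega)
        have f4 : ((n0 : ℝ) + 3 / 2) * π ≤ ((n : ℝ) + 1 / 2) * π := mul_le_mul_of_nonneg_right (by linarith) pi_pos.le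
        have f2 : ((n0 : ℝ) + 1) * val piH ≤ ((n0 : ℝ) + 1) * (π + 1 / 2 ^ 30) :=
          mul_le_mul_of_nonneg_left (by linarith [hπ.1]) (by positivity)
        have e : π / 2 ≤ ((n0 : ℝ) + 1) / 2 ^ 30 := by nlinarith
        have e' : ((n0 : ℝ) + 1) / 2 ^ 30 ≤ (2 ^ 24 / 3 + 1) / 2 ^ 30 := by gcongr
        nlinarith
      -- n0 ≤ n
      have hdown : (n0 : ℤ) ≤ n := by
        by_contra hlt
        have hlt' : (n : ℝ) + 1 ≤ n0 := by exact_mod_cast (show n + 1 ≤ (n0 : ℤ) by omega)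
        have e1 : val hi < ((n : ℝ) + 1) * π := by nlinarith [hπ.1]
        have f6 : (n0 : ℝ) * π ≤ (n0 : ℝ) * val piH := mul_le_mul_of_nonneg_left hπ.2 (Nat.cast_nonneg n0)
        have f7 : ((n : ℝ) + 1) * π ≤ (n0 : ℝ) * π := mul_le_mul_of_nonneg_right hlt' pi_pos.le
        linarith
      have hn_eq : n = (n0 : ℤ) := le_antisymm hup hdown
      subst hn_eq
      have hhit : hit lo hi piL piH n0 = true :=
        hit_of_mem n0 hπ (by exact_mod_cast hcl) (by exact_mod_cast hch)
      have hx : crossB lo hi piL piH = true := by unfold crossB; simp only [← hn0, hhit, Bool.true_or]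
      rw [hc] at hx
      exact Bool.false_ne_true hx
    -- endpoint bound
    refine (abs_sin_le_max_of_no_crit h1 h2 hnocrit).trans ?_
    rw [val_max]
    obtain ⟨n1, hn1⟩ := exists_abs_sub_le_val_distU lo piL piH hπ
    obtain ⟨n2, hn2⟩ := exists_abs_sub_le_val_distU hi piL piH hπ
    exact max_le_max (abs_sin_le_val_p5U n1 hn1) (abs_sin_le_val_p5U n2 hn2)

end Summit.RiemannHypothesis.RiemannHypothesis.Theorems.ThetaTier2
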